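import Literature.AlgebraicGeometry.Resolution.InseparableLocalUniformizationLemmas
import Literature.AlgebraicGeometry.Resolution.InseparableLocalUniformizationDescentStepZero
import Literature.AlgebraicGeometry.Resolution.CompositeValuationsCofinal
import HarnessLib

/-!
# Inseparable local uniformization, §4.2: bricks for Steps 1–2 of the induction on the height

Topic: `Literature/AlgebraicGeometry/Resolution`. M. Temkin, *Inseparable local uniformization*,
J. Algebra 373 (2013) 65–119 = arXiv:0804.1554v3 (numbering of this version), §4.2 "Induction on
height" (pp. 50–51). The plan (see `InseparableLocalUniformizationEngine.lean`): PROVE the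
packaged fact `Temkin2013HeightStepOfDescent` from `Temkin2013Descent` (Thm. 4.1.1),
`Temkin2013_Lemma332` (Lemma 3.3.2) and `Temkin2013_Steps34` (Steps 3–4 of the proof of
Thm. 4.1.1) by formalizing Steps 0–2 of §4.2. This file PROVES the self-contained bricks of
Steps 1–2 which do not involve the induction hypothesis:

* `Temkin2013DescentConclusion.relConclusion_self` — the descent conclusion for the trivial
  valued extension `(K, K°)/(K, K°)` is the conclusion of (the corrected) Thm. 1.3.2
  (Remark 4.1.2: "The case of `n = 1` in Theorem 4.1.1 covers our needs").
* Step 1, "`x` is a closed point of `X_η`" (p. 50): for `k̄ ⊆ F°` with `F̃` algebraic over the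
  residues of `k̄` and a `k̄`-subalgebra `A_η ⊆ F°`, the centre `x = 𝔪_{F°} ∩ A_η` is a MAXIMAL
  ideal (`centreIdeal_isMaximal_of_isResiduallyAlgebraicOver`), via the embedding
  `k(x) = A_η/x ↪ F̃` (`quotCentreToResidueField`, injective) and `k̄ ↠ k̄P` (`toResField`).
* Step 2, "the valuation on `F̃` induces a … valuation on `m = k(x)`, which agrees on `k̄ ⊂ m`
  with the valuation induced by `k̄ ↪ K`" (p. 51): `residuePointValuationSubring` (`m°`, the
  pull-back of `F̃° = K°/𝔪_{F°}` along `k(x) ↪ F̃`), `residuePointValuationSubring_comap`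
  (`m° ∩ k̄ = k̄°`), `map_mem_residuePointValuationSubring_iff` (`A_η ∩ K°` maps into `m°`: the
  morphism `i : S_m → X_S`), `map_mem_maximalIdeal_residuePoint_iff` (the closed point of `S_m`
  goes to the centre of `K°`: "`z_S` is the center of `K°` on `X′_S` because `K°` is composed
  from `F°` and `F̃°`").
* Step 2, "`X_S = Nr_K(X ×_Y S)` is an integral nft scheme over `S`" (p. 51):
  `isAffineNormalizedModel_etaModel` (`etaModel k̄ (Nr_K A) k̄°` is an affine normalized
  `Spec k̄°`-model with function field `K`, the shape Lemma 3.3.2 and `Temkin2013_Steps34`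
  expect), `etaModel_le_valuationSubring` (`X_S ⊆ K°`), and `Nr_K` bookkeeping
  (`nrIn_eq_nrIn_of_le_of_le`, `nrIn_le_valuationSubring`, `nrIn_eq_self_of_normal`).
* Step 1, "any refinement `X′_η → X_η` of affine `k̄`-models of `F°` can be extended to a
  refinement `X′ → X` of affine `k`-models of `K°`" (p. 50): `exists_refinement_adjoin_eq`, by
  rescaling generators with `exists_mul_mem_of_isResiduallyAlgebraicOver`
  (`CompositeValuationsCofinal.lean`).

## Source

* M. Temkin, *Inseparable local uniformization*, arXiv:0804.1554v3, §4.2, Steps 1–2 (pp. 50–51);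
  Remark 4.1.2 (p. 47).
-/

noncomputable section

open IsLocalRing

namespace Literature.AlgebraicGeometry.Resolution

universe u

/-! ### From the descent conclusion with `K₁ = K` to the conclusion of Thm. 1.3.2 -/

section selfConclusion

variable {k K : Type u} [Field k] [Field K] [Algebra k K]

/-- The descent conclusion for the trivial extension `(K, K°)/(K, K°)` gives the conclusion of
(the corrected) Thm. 1.3.2: `L = L₁`, same `l`, `X′`, `L°`, `Nr_L(X′)` (Temkin 2013, Remark
4.1.2: "The case of `n = 1` in Theorem 4.1.1 covers our needs"). [folklore] -/
theorem Temkin2013DescentConclusion.relConclusion_self (O : ValuationSubring K)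
    (A : Subalgebra k K) (h : Temkin2013DescentConclusion k K O A K O) :
    Temkin2013RelConclusion k K O A := by
  obtain ⟨L₁, iF, iA1, iA, iAk, iT1, iT2, hfin, hpi, l, hlfin, hlpi, L, hlL, hLpi, hadj,
    A', hAA', hA'O, hA'fg, hA'fr, O₁', hO₁', N, hN, hNint, hNfg, hNfr, hsm, hsep, hreg⟩ := h
  -- the two `K`-algebra structures on `L₁` coincide
  have hsmul : ∀ (c : K) (z : L₁), @HSMul.hSMul K L₁ L₁ (@instHSMul _ _ iA1.toSMul) c z =
      @HSMul.hSMul K L₁ L₁ (@instHSMul _ _ iA.toSMul) c z := fun c z => by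
    have := iT1.smul_assoc c (1 : K) z
    have h1 : @HSMul.hSMul K L₁ L₁ (@instHSMul _ _ iA1.toSMul) (1 : K) z = z := by
      letI : Algebra K L₁ := iA1
      exact one_smul K z
    rw [h1] at this
    simpa using this
  have heq : iA1 = iA := by
    refine Algebra.algebra_ext _ _ fun r => ?_
    rw [@Algebra.algebraMap_eq_smul_one K L₁ _ _ iA1, @Algebra.algebraMap_eq_smul_one K L₁ _ _ iA,
      hsmul]
  subst heq
  exact ⟨L₁, iF, iA1, iAk, iT2, hfin, hpi, l, hlfin, hlpi, A', hAA', hA'O, hA'fg, hA'fr, O₁', hO₁',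
    N, hN, hNint, hNfg, hNfr, hsm, hsep, hreg⟩

end selfConclusion

/-! ### The centre of the coarsening on the generic fibre is a closed point (§4.2, Step 1) -/

section closedPoint

variable {k K : Type u} [Field k] [Field K] [Algebra k K]
variable (O₁ : ValuationSubring K) (kb : IntermediateField k K)
  (Aη : Subalgebra kb K) (hA : Aη.toSubring ≤ O₁.toSubring)

/-- The reduction map `A_η → F̃ = F°/𝔪_{F°}` of a `k̄`-subalgebra `A_η ⊆ F°`. [folklore] -/
def toResidueField : Aη →+* ResidueField O₁ :=
  (residue O₁).comp (Subring.inclusion hA)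

/-- Its kernel is the centre `x = 𝔪_{F°} ∩ A_η` of `F°` on `Spec A_η`. [folklore] -/
theorem ker_toResidueField : RingHom.ker (toResidueField O₁ kb Aη hA) = centreIdeal Aη O₁ hA := by
  ext a
  rw [RingHom.mem_ker]
  change residue O₁ (Subring.inclusion hA a) = 0 ↔ a ∈ centreIdeal Aη O₁ hA
  rw [residue_eq_zero_iff]
  rfl

/-- The induced embedding `k(x) = A_η/x ↪ F̃`. [folklore] -/
def quotCentreToResidueField : Aη ⧸ centreIdeal Aη O₁ hA →+* ResidueField O₁ :=
  Ideal.Quotient.lift (centreIdeal Aη O₁ hA) (toResidueField O₁ kb Aη hA) fun a ha => by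
    rw [← RingHom.mem_ker, ker_toResidueField]; exact ha

/-- `quotCentreToResidueField` on classes. [folklore] -/
@[simp] theorem quotCentreToResidueField_mk (a : Aη) :
    quotCentreToResidueField O₁ kb Aη hA (Ideal.Quotient.mk _ a) =
      residue O₁ ⟨(a : K), hA a.2⟩ := rfl

/-- `k(x) ↪ F̃` is injective. [folklore] -/
theorem quotCentreToResidueField_injective :
    Function.Injective (quotCentreToResidueField O₁ kb Aη hA) := by
  intro a b hab
  obtain ⟨a, rfl⟩ := Ideal.Quotient.mk_surjective a
  obtain ⟨b, rfl⟩ := Ideal.Quotient.mk_surjective b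
  rw [Ideal.Quotient.eq, ← ker_toResidueField, RingHom.mem_ker, map_sub, sub_eq_zero]
  exact hab

/-- The reduction `k̄ → k̄P ⊆ F̃` of the subfield `k̄ ⊆ F°` onto its residue field. [folklore] -/
def toResField (hkb : ∀ c : kb, (c : K) ∈ O₁) : kb →+* resField O₁ kb.toSubfield :=
  ((residue O₁).comp ((algebraMap kb K).codRestrict O₁ fun c => hkb c)).codRestrict _ fun c =>
    residue_mem_resField O₁ ⟨(c : K), hkb c⟩ c.2

/-- `toResField` is onto: every residue of an element of `F° ∩ k̄ = k̄` is hit. [folklore] -/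
theorem toResField_surjective (hkb : ∀ c : kb, (c : K) ∈ O₁) :
    Function.Surjective (toResField O₁ kb hkb) := by
  rintro ⟨r, hr⟩
  obtain ⟨a, ha, rfl⟩ := (mem_resField_iff O₁ _ r).mp hr
  refine ⟨⟨(a : K), ha⟩, Subtype.ext ?_⟩
  change residue O₁ ⟨((⟨(a : K), ha⟩ : kb) : K), _⟩ = residue O₁ a
  congr 1

/-- **The centre of `F°` on the generic fibre is a closed point** (Temkin 2013, §4.2, Step 1,
p. 50: "Let `x` be the center of `F°`. Since `k(x) ⊂ F̃` and `F̃` is algebraic over `k̄`, we have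
that `x` is a closed point of `X_η`"): if `k̄ ⊆ F°` and `F̃` is algebraic over the residues of `k̄`,
then for every `k̄`-subalgebra `A_η ⊆ F°` the centre `𝔪_{F°} ∩ A_η` is a maximal ideal: `A_η/x`
embeds into `F̃`, so it is a domain algebraic (hence integral) over the field `k̄`, hence a
field. PROVED. [cite: Temkin2013, Section 4.2, Step 1 (p. 50)] -/
theorem centreIdeal_isMaximal_of_isResiduallyAlgebraicOver (hkb : ∀ c : kb, (c : K) ∈ O₁)
    (hres : IsResiduallyAlgebraicOver O₁ kb.toSubfield ⊤) :
    (centreIdeal Aη O₁ hA).IsMaximal := by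
  set x := centreIdeal Aη O₁ hA with hx
  have halg : ∀ a : Aη ⧸ x, IsAlgebraic kb a := fun a => by
    obtain ⟨a, rfl⟩ := Ideal.Quotient.mk_surjective a
    refine IsAlgebraic.of_ringHom_of_comp_eq (toResField O₁ kb hkb)
      (quotCentreToResidueField O₁ kb Aη hA) ?_ (toResField_surjective O₁ kb hkb)
      (quotCentreToResidueField_injective O₁ kb Aη hA) ?_
    · rw [quotCentreToResidueField_mk]
      exact hres _ (residue_mem_resField O₁ _ (Subfield.mem_top _))
    · ext c
      rfl
  haveI : Algebra.IsIntegral kb (Aη ⧸ x) := ⟨fun a => (halg a).isIntegral⟩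
  have hfield : IsField (Aη ⧸ x) :=
    isField_of_isIntegral_of_isField' (R := kb) (S := Aη ⧸ x) (Field.toIsField kb)
  exact Ideal.Quotient.maximal_of_isField x hfield

end closedPoint

/-! ### The valuation on `m = k(x)` induced by `F̃°` (§4.2, Step 2) -/

section residuePoint

variable {k K : Type u} [Field k] [Field K] [Algebra k K]
variable (O O₁ : ValuationSubring K) (h : O ≤ O₁) (kb : IntermediateField k K)
  (Aη : Subalgebra kb K) (hA : Aη.toSubring ≤ O₁.toSubring)
  {m : Type u} [Field m] [Algebra kb m] (φ : Aη →ₐ[kb] m) (ψ : m →+* ResidueField O₁)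
  (hψφ : ∀ a : Aη, ψ (φ a) = residue O₁ ⟨(a : K), hA a.2⟩)

/-- **The valuation ring `m°` of `m = k(x) ⊆ F̃` induced by `F̃° = K°/𝔪_{F°}`** (Temkin 2013,
§4.2, Step 2, p. 51: "The field `m := k(x)` embeds into `F̃` because `F` is centered on `x`,
hence the valuation on `F̃` induces a height one valuation on `m`"): the pull-back of the
residue valuation ring along `k(x) ↪ F̃`. [cite: Temkin2013, Section 4.2, Step 2 (p. 51)] -/
def residuePointValuationSubring : ValuationSubring m :=
  (residueValuationSubring O O₁ h).comap ψ

include hψφ in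
/-- An element of `A_η` maps into `m°` iff it lies in `K°` (`K°` is the preimage of `F̃°`).
[folklore] -/
theorem map_mem_residuePointValuationSubring_iff (a : Aη) :
    φ a ∈ residuePointValuationSubring O O₁ h ψ ↔ (a : K) ∈ O := by
  change ψ (φ a) ∈ residueValuationSubring O O₁ h ↔ _
  rw [hψφ, residue_mem_residueValuationSubring_iff]

include hψφ in
/-- **`m°` agrees on `k̄ ⊆ m` with the valuation induced by `k̄ ↪ K`** (loc. cit.: "which agrees
on `k̄ ⊂ m` with the valuation induced by the embedding `k̄ ↪ K`").
[cite: Temkin2013, Section 4.2, Step 2 (p. 51)] -/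
theorem residuePointValuationSubring_comap :
    (residuePointValuationSubring O O₁ h ψ).comap (algebraMap kb m) =
      O.comap (algebraMap kb K) := by
  ext c
  rw [ValuationSubring.mem_comap, ValuationSubring.mem_comap, ← φ.commutes c,
    map_mem_residuePointValuationSubring_iff O O₁ h kb Aη hA φ ψ hψφ]
  rfl

include hψφ in
/-- For `a ∈ A_η ∩ K°`: `φ a` lies in the maximal ideal of `m°` iff `a` lies in the maximal ideal of
`K°` (the image of the closed point of `S_m` is the centre of `K°`; loc. cit.: "Note that `z_S` is
the center of `K°` on `X′_S` because `K°` is composed from `F°` and `F̃°`").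
[cite: Temkin2013, Section 4.2, Step 2 (p. 51)] -/
theorem map_mem_maximalIdeal_residuePoint_iff (a : Aη) (haO : (a : K) ∈ O) :
    (⟨φ a, (map_mem_residuePointValuationSubring_iff O O₁ h kb Aη hA φ ψ hψφ a).mpr haO⟩ :
        residuePointValuationSubring O O₁ h ψ) ∈
      maximalIdeal (residuePointValuationSubring O O₁ h ψ) ↔
    (⟨(a : K), haO⟩ : O) ∈ maximalIdeal O := by
  set Om := residuePointValuationSubring O O₁ h ψ with hOm
  rw [IsLocalRing.mem_maximalIdeal, IsLocalRing.mem_maximalIdeal, mem_nonunits_iff,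
    mem_nonunits_iff, not_iff_not]
  have hres_a : residue O₁ ⟨(a : K), hA a.2⟩ = ψ (φ a) := (hψφ a).symm
  by_cases hφ : φ a = 0
  · -- `φ a = 0`: `a ∈ 𝔪_{F°} ⊆ 𝔪_{K°}`, neither side is a unit
    constructor
    · intro hu
      exact absurd (Subtype.ext hφ : (⟨φ a, _⟩ : Om) = 0) hu.ne_zero
    · intro hu
      exfalso
      have hainv : (a : K)⁻¹ ∈ O := inv_mem_of_isUnit O haO hu
      have ha0 : (a : K) ≠ 0 := fun h0 => hu.ne_zero (Subtype.ext h0)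
      have hunit₁ : IsUnit (⟨(a : K), hA a.2⟩ : O₁) := isUnit_of_inv_mem O₁ (hA a.2) (h hainv) ha0
      apply (IsLocalRing.mem_maximalIdeal _).mp ((residue_eq_zero_iff _).mp ?_) hunit₁
      rw [hres_a, hφ, map_zero]
  · have ha0 : (a : K) ≠ 0 := fun h0 => hφ (by rw [show a = 0 from Subtype.ext h0, map_zero])
    -- `a ∉ 𝔪_{F°}`: `a⁻¹ ∈ F°`
    have hainv₁ : (a : K)⁻¹ ∈ O₁ := by
      by_contra hni
      apply hφ
      have h0 : residue O₁ ⟨(a : K), hA a.2⟩ = 0 := residue_mk_eq_zero_of_inv_notMem O₁ (hA a.2) hni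
      rw [hres_a] at h0
      exact (map_eq_zero ψ).mp h0
    have key : (φ a)⁻¹ ∈ Om ↔ (a : K)⁻¹ ∈ O := by
      change ψ (φ a)⁻¹ ∈ residueValuationSubring O O₁ h ↔ _
      rw [map_inv₀, ← hres_a, ← residue_mk_inv O₁ (hA a.2) hainv₁ ha0,
        residue_mem_residueValuationSubring_iff]
    have hφa : φ a ∈ Om := (map_mem_residuePointValuationSubring_iff O O₁ h kb Aη hA φ ψ hψφ a).mpr haO
    constructor
    · intro hu
      exact isUnit_of_inv_mem O haO (key.mp (inv_mem_of_isUnit Om hφa hu)) ha0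
    · intro hu
      exact isUnit_of_inv_mem Om hφa (key.mpr (inv_mem_of_isUnit O haO hu)) (fun h0 => hφ h0)

end residuePoint

/-! ### `Nr_K` bookkeeping for the base change `X_S = Nr_K(X ×_Y S)` -/

section etaModelAlgebra

variable {k K : Type u} [Field k] [Field K] [Algebra k K]

/-- Two subrings with the same integral closure. [folklore] -/
theorem nrIn_eq_nrIn_of_le_of_le {T₁ T₂ : Subring K} (h₁ : T₁ ≤ nrIn T₂) (h₂ : T₂ ≤ nrIn T₁) :
    nrIn T₁ = nrIn T₂ :=
  le_antisymm (by simpa only [nrIn_nrIn] using nrIn_mono h₁)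
    (by simpa only [nrIn_nrIn] using nrIn_mono h₂)

/-- `Nr_K(T)` lies in every valuation ring containing `T` (valuation rings are integrally
closed). [folklore] -/
theorem nrIn_le_valuationSubring {T : Subring K} (O : ValuationSubring K) (hT : T ≤ O.toSubring) :
    nrIn T ≤ O.toSubring := by
  intro x hx
  letI : Algebra T O := (Subring.inclusion hT).toAlgebra
  haveI : IsScalarTower T O K := IsScalarTower.of_algebraMap_eq (fun _ => rfl)
  have hx' : IsIntegral O x := (mem_nrIn_iff.mp hx).tower_top
  obtain ⟨y, rfl⟩ := IsIntegrallyClosed.algebraMap_eq_of_integral hx'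
  exact y.2

/-- A normal subring is its own `K`-normalization. [folklore] -/
theorem nrIn_eq_self_of_normal {T : Subring K} (hT : ∀ x : K, IsIntegral T x → x ∈ T) :
    nrIn T = T :=
  le_antisymm (fun x hx => hT x (mem_nrIn_iff.mp hx)) (le_nrIn T)

/-- Mapping along the identity. [folklore] -/
theorem subring_map_algebraMap_self (T : Subring K) : T.map (algebraMap K K) = T := by
  ext x; simp

variable {kb : Type u} [Field kb] [Algebra kb K]

/-- **`X_S = Nr_K(X ×_Y S)` is an affine normalized `S`-model** for `S = Spec R₀`, `R₀ ⊆ k̄`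
containing `k`, and any affine `k`-model `X = Spec A` of (a subring of) `K` (Temkin 2013, §4.2,
Step 2, p. 51: "`X_S = Nr_K(X ×_Y S)` is an integral nft scheme over `S`"; §4.1, Step 1, p. 47:
"`C = Nr_K(X ×_Y S)`, which is an integral nft scheme over `S` and with `K →~ k(C)`"): with
`T = Nr_K(A)`, `etaModel k̄ T R₀ = Nr_K(R₀[t])` for generators `t` of `A` over `k`, and
`Frac = K`. [cite: Temkin2013, Section 4.2, Step 2 (p. 51)] -/
theorem isAffineNormalizedModel_etaModel [Algebra k kb] [IsScalarTower k kb K]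
    (A : Subalgebra k K) (t : Finset K) (ht : Algebra.adjoin k (t : Set K) = A)
    (hAfr : IsFractionRing A K) (R₀ : Subring kb) (hk : ∀ c : k, algebraMap k kb c ∈ R₀) :
    IsAffineNormalizedModel ⊤ (R₀.map (algebraMap kb K)) (etaModel kb (nrIn A.toSubring) R₀) := by
  obtain ⟨C, hC⟩ : ∃ C : Subring K, C = Subring.closure (↑(R₀.map (algebraMap kb K)) ∪ (t : Set K)) :=
    ⟨_, rfl⟩
  have hkR : Set.range (algebraMap k K) ⊆ ↑(R₀.map (algebraMap kb K)) := by
    rintro _ ⟨c, rfl⟩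
    exact ⟨algebraMap k kb c, hk c, (IsScalarTower.algebraMap_apply k kb K c).symm⟩
  have hAC : A.toSubring ≤ C := by
    rw [← ht, Algebra.adjoin_eq_ring_closure, hC]
    exact Subring.closure_mono (Set.union_subset_union_left _ hkR)
  have htA : (t : Set K) ⊆ A := by rw [← ht]; exact Algebra.subset_adjoin
  have hRC : R₀.map (algebraMap kb K) ≤ C := by
    rw [hC]; exact fun x hx => Subring.subset_closure (Or.inl hx)
  have hCle : C ≤ nrIn A.toSubring ⊔ R₀.map (algebraMap kb K) := by
    rw [hC, Subring.closure_le]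
    refine Set.union_subset (fun x hx => (le_sup_right : R₀.map (algebraMap kb K) ≤ _) hx)
      fun x hx => ?_
    exact (le_sup_left : nrIn A.toSubring ≤ _) (le_nrIn _ (htA hx))
  -- the two generating rings have the same normalization
  have heq : etaModel kb (nrIn A.toSubring) R₀ = nrIn C := by
    refine nrIn_eq_nrIn_of_le_of_le (sup_le ?_ (hRC.trans (le_nrIn C))) (hCle.trans (le_nrIn _))
    have h1 : nrIn A.toSubring ≤ nrIn C := nrIn_mono hAC
    have h2 : nrIn (nrIn A.toSubring) ≤ nrIn (nrIn C) := nrIn_mono h1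
    rw [nrIn_nrIn, nrIn_nrIn] at h2
    exact h2
  refine ⟨t, fun _ _ => trivial, ?_, fun z => ?_⟩
  · rw [heq, hC]
    rfl
  · haveI := hAfr
    obtain ⟨a, b, -, rfl⟩ := IsFractionRing.div_surjective (A := A) z
    have hle : A.toSubring ≤ etaModel kb (nrIn A.toSubring) R₀ :=
      (le_nrIn A.toSubring).trans (le_etaModel _ _)
    exact ⟨a, hle a.2, b, hle b.2, rfl⟩

/-- `X_S ⊆ K°`: `Nr_K(Nr_K(A)·R₀) ⊆ O` when `A ⊆ O` and `R₀ ⊆ O ∩ k̄`. [folklore] -/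
theorem etaModel_le_valuationSubring (A : Subalgebra k K) (O : ValuationSubring K)
    (hAO : A.toSubring ≤ O.toSubring) (R₀ : Subring kb)
    (hR₀ : ∀ c ∈ R₀, algebraMap kb K c ∈ O) :
    etaModel kb (nrIn A.toSubring) R₀ ≤ O.toSubring := by
  refine nrIn_le_valuationSubring O (sup_le (nrIn_le_valuationSubring O hAO) ?_)
  rintro _ ⟨c, hc, rfl⟩
  exact hR₀ c hc

end etaModelAlgebra

/-! ### Extending a refinement of the generic fibre to a refinement of the model (§4.2, Step 1) -/

section extendRefinement

variable {k K : Type u} [Field k] [Field K] [Algebra k K]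

/-- **A refinement of `X_η` extends to a refinement of `X`** (Temkin 2013, §4.2, Step 1, p. 50:
"Note that any refinement `X′_η → X_η` of affine `k̄`-models of `F°` can be extended to a
refinement `X′ → X` of affine `k`-models of `K°`"): if `A ⊆ K°` is an affine `k`-model and
`A′_η ⊇ k̄[A]` a finitely generated `k̄`-subalgebra of `F°`, where `F°` is a coarsening of `K°`
whose residue field is algebraic over the residues of `k̄`, then some finitely generated
`A ⊆ A₂ ⊆ K°` has `k̄[A₂] = A′_η`: rescale generators of `A′_η` into `K°` by non-zero elements of
`k̄` (`exists_mul_mem_of_isResiduallyAlgebraicOver`). PROVED.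
[cite: Temkin2013, Section 4.2, Step 1 (p. 50)] -/
theorem exists_refinement_adjoin_eq (O O₁ : ValuationSubring K) (h : O ≤ O₁)
    (hk : ∀ c : k, algebraMap k K c ∈ O) (kb : IntermediateField k K)
    (hres : IsResiduallyAlgebraicOver O₁ kb.toSubfield ⊤)
    (A : Subalgebra k K) (hAO : A.toSubring ≤ O.toSubring) (hAfg : A.FG)
    (Aη' : Subalgebra kb K) (hAη'O₁ : Aη'.toSubring ≤ O₁.toSubring) (hAη'fg : Aη'.FG)
    (hle : Algebra.adjoin kb (A : Set K) ≤ Aη') :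
    ∃ A₂ : Subalgebra k K, A ≤ A₂ ∧ A₂.toSubring ≤ O.toSubring ∧ A₂.FG ∧
      Algebra.adjoin kb (A₂ : Set K) = Aη' := by
  classical
  obtain ⟨t, ht⟩ := hAfg
  obtain ⟨g, hg⟩ := hAη'fg
  have hgA : (g : Set K) ⊆ Aη' := by rw [← hg]; exact Algebra.subset_adjoin
  have htA : (t : Set K) ⊆ A := by rw [← ht]; exact Algebra.subset_adjoin
  -- rescale the generators of `A′_η` into `K°`
  have hscale : ∀ x : K, x ∈ g → ∃ c : K, c ∈ kb ∧ c ≠ 0 ∧ c * x ∈ O := fun x hx => by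
    obtain ⟨c, hc, hc0, hcx⟩ := exists_mul_mem_of_isResiduallyAlgebraicOver O O₁ h kb.toSubfield
      hres (hAη'O₁ (hgA hx))
    exact ⟨c, hc, hc0, hcx⟩
  choose c hc hc0 hcO using hscale
  let s' : Finset K := g.attach.image fun x => c x.1 x.2 * x.1
  have hs'O : (s' : Set K) ⊆ (O : Set K) := by
    intro x hx
    obtain ⟨y, -, rfl⟩ := Finset.mem_image.mp (Finset.mem_coe.mp hx)
    exact hcO y.1 y.2
  have hs'A : (s' : Set K) ⊆ (Aη' : Set K) := by
    intro x hx
    obtain ⟨y, -, rfl⟩ := Finset.mem_image.mp (Finset.mem_coe.mp hx)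
    have : (⟨c y.1 y.2, hc y.1 y.2⟩ : kb) • (y.1 : K) ∈ Aη' := Aη'.smul_mem (hgA y.2) _
    rwa [Algebra.smul_def] at this
  let Oalg : Subalgebra k K := { O.toSubring.toSubsemiring with algebraMap_mem' := hk }
  refine ⟨Algebra.adjoin k (↑t ∪ ↑s'), ?_, ?_, ⟨t ∪ s', by rw [Finset.coe_union]⟩, ?_⟩
  · rw [← ht]; exact Algebra.adjoin_mono Set.subset_union_left
  · have : Algebra.adjoin k (↑t ∪ ↑s' : Set K) ≤ Oalg :=
      Algebra.adjoin_le (Set.union_subset (htA.trans hAO) hs'O)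
    exact fun x hx => this hx
  · rw [Algebra.adjoin_adjoin_of_tower]
    refine le_antisymm (Algebra.adjoin_le (Set.union_subset ?_ hs'A)) ?_
    · exact fun x hx => hle (Algebra.subset_adjoin (htA hx))
    · rw [← hg]
      refine Algebra.adjoin_le fun y hy => ?_
      have hmem : c y hy * y ∈ Algebra.adjoin kb (↑t ∪ ↑s' : Set K) :=
        Algebra.subset_adjoin (Or.inr (Finset.mem_coe.mpr
          (Finset.mem_image.mpr ⟨⟨y, hy⟩, Finset.mem_attach _ _, rfl⟩)))
      have : (⟨c y hy, hc y hy⟩ : kb)⁻¹ • (c y hy * y) ∈ Algebra.adjoin kb (↑t ∪ ↑s' : Set K) :=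
        Subalgebra.smul_mem _ hmem _
      rw [Algebra.smul_def, map_inv₀] at this
      change (c y hy)⁻¹ * (c y hy * y) ∈ _ at this
      rwa [inv_mul_cancel_left₀ (hc0 y hy)] at this

end extendRefinement





end Literature.AlgebraicGeometry.Resolution
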